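import Summits.QuantumFields.YangMills.Theorems.BalabanLadderNTCornerPriceSU2
import HarnessLib

/-!
# Crux `NT` (stmt-QuantumFields-19353), stub `stub_refpkgT : RefPkgT`: THE CORNER PRICE, IV — the numbers at the fundamental
# representation of `SU(N)`, every `N`: `C₁ ≥ 6N(1 − cos(2π⌊N/2⌋/N))` (`= 12N` for even `N`, `= 27` for `SU(3)`,
# `= 6N(1 + cos(π/N))` for odd `N`)

Helper file (`--supports stmt-QuantumFields-19353`) of the fleet lead prover of crux `NT` (unit `ym-spine-19353-p1`, GEN 14);
sequel of `…NTCornerPrice`, `…NTCornerPriceThreePoint`, `…NTCornerPriceSU2` (GEN 13).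

GEN 13 proved (`six_mul_sub_trace_le_of_e1osc[_at]`) that clause 1 of the registered package, read on the unit cube, forces
`C₁ ≥ D(g) := 6 (N − Re tr ρ(g))` for every `g ∈ G`, and evaluated it at `−1 ∈ SU(2)` (`C₁ ≥ 24`).  This file evaluates it at
the fundamental representation of `SU(N)` for EVERY `N`, at the centre element

  `z_N := exp(2πi ⌊N/2⌋ / N) · 1 ∈ SU(N)`   (`det z_N = exp(2πi ⌊N/2⌋) = 1`),

whose trace has real part `N cos(2π⌊N/2⌋/N)`:

* §1 `exp_centreAngle_pow`, `centre_smul_one_mem_specialUnitaryGroup`, `fundamentalLatticeRep_centre`, `re_trace_centre_smul_one`,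
  `six_mul_sub_trace_centre` — the witness and `D(z_N) = 6N(1 − cos(2π⌊N/2⌋/N))`;
* §2 **`corner_le_C₁_of_e1osc_at_SUN`** / **`corner_le_C₁_of_e1osc_SUN`** — clause 1 at `fundamentalLatticeRep N` (one coupling, resp. the
  registered `∃ β₁ ∀ β ≥ β₁` form with `a → 0`, `ℓ > 0`) forces **`6N(1 − cos(2π⌊N/2⌋/N)) ≤ C₁`**;
* §3 the closed forms: `neg_one_mem_specialUnitaryGroup_of_even` + **`twelve_mul_le_C₁_of_e1osc_at_even`** (`12N ≤ C₁`, even `N`);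
  `cos_centreAngle_odd` (`cos(2π⌊N/2⌋/N) = −cos(π/N)` for odd `N`) + **`odd_corner_le_C₁_of_e1osc_at`** (`6N(1 + cos(π/N)) ≤ C₁`, odd `N`);
  **`twentyseven_le_C₁_of_e1osc_at_SU3`** (`27 ≤ C₁` at the fundamental representation of `SU(3)`, the group of `YangMillsOS`);
* §4 `six_mul_sub_trace_le_twelve_mul` — `D(g) ≤ 12N` for every `g` and every lattice representation (unitarity), so for even `N`
  the value `12N` is the OPTIMAL corner price; for odd `N` the centre value `6N(1 + cos(π/N))` is the minimum of `D` over the centre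
  (the minimum of `Re tr` over all of `SU(N)`, `N` odd, is `−N cos(π/N)` — not needed and not proved here);
* §5 the corner floors of the clause-4 / clause-5 margins at `SU(N)`: **`q2_ge_cornerSUN_of_clause4_at`**
  (`ε + 2D_N²·((s/κ)⁴S_θ)((s/κ)⁴S_v) ≤ Q2(θv,v)`) and **`absQ3_ge_cornerSUN_of_clause5_at`** (`ε + 2D_N³(s/κ)¹²S_fS_gS_h ≤ |Q3|`),
  `D_N = 6N(1 − cos(2π⌊N/2⌋/N))`; at `SU(3)`: `1458` and `39366`.

NUMBERS.  `D_2 = 24`, `D_3 = 27`, `D_4 = 48`, `D_5 ≈ 54.3`, `D_N → 12N`; floors `2D_N²‖v‖₁²/κ⁸` (`1152, 1458, 4608, …`),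
`2D_N³∏‖·‖₁/κ¹²` (`27648, 39366, 221184, …`).  HONEST FRAMING: arithmetic over the GEN 13 corner-price theorems; necessary conditions
on instances of the registered stub; no floor, not AF, not NT, not the seam, not the gap; not Clay.
-/

set_option autoImplicit false

noncomputable section

open scoped SchwartzMap
open MeasureTheory Filter Topology
open Literature.MathematicalPhysics.QuantumFieldTheory Literature.MathematicalPhysics.QuantumLattice
open Literature.Probability.LatticeModels
open Summit.QuantumFields.YangMills.Cruxes.OSLegsFromFemtoAndGap.DlrCollarTransfer

namespace Summit.QuantumFields.YangMills.Cruxes.NT.CornerPrice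

/-! ## §1 The centre witness `z_N = exp(2πi⌊N/2⌋/N)·1 ∈ SU(N)` -/

section Centre

variable (N : ℕ)

/-- `exp(i·2π⌊N/2⌋/N)^N = 1`. [folklore] -/
theorem exp_centreAngle_pow :
    Complex.exp (↑(2 * Real.pi * ((N / 2 : ℕ) : ℝ) / N) * Complex.I) ^ N = 1 := by
  rcases Nat.eq_zero_or_pos N with hN | hN
  · subst hN; simp
  · rw [← Complex.exp_nat_mul]
    have hN' : (N : ℂ) ≠ 0 := by exact_mod_cast hN.ne'
    have e : (N : ℂ) * (↑(2 * Real.pi * ((N / 2 : ℕ) : ℝ) / N) * Complex.I) =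
        ((N / 2 : ℕ) : ℂ) * (2 * Real.pi * Complex.I) := by
      push_cast
      field_simp
    rw [e]
    exact Complex.exp_nat_mul_two_pi_mul_I _

/-- `|exp(iθ)|² = 1` in the form `exp(iθ) · conj exp(iθ) = 1`. [folklore] -/
theorem exp_mul_conj_eq_one (θ : ℝ) : Complex.exp (↑θ * Complex.I) * (starRingEnd ℂ) (Complex.exp (↑θ * Complex.I)) = 1 := by
  rw [Complex.mul_conj, Complex.normSq_eq_norm_sq, Complex.norm_exp_ofReal_mul_I]
  simp

/-- **The centre element `z_N = exp(2πi⌊N/2⌋/N)·1` lies in `SU(N)`.** [folklore] -/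
theorem centre_smul_one_mem_specialUnitaryGroup :
    Complex.exp (↑(2 * Real.pi * ((N / 2 : ℕ) : ℝ) / N) * Complex.I) • (1 : Matrix (Fin N) (Fin N) ℂ) ∈
      Matrix.specialUnitaryGroup (Fin N) ℂ := by
  rw [Matrix.mem_specialUnitaryGroup_iff]
  refine ⟨?_, ?_⟩
  · rw [Matrix.mem_unitaryGroup_iff, Matrix.star_eq_conjTranspose, Matrix.conjTranspose_smul, Matrix.conjTranspose_one,
      smul_mul_smul_comm, mul_one, Complex.star_def, exp_mul_conj_eq_one, one_smul]
  · rw [Matrix.det_smul, Matrix.det_one, mul_one, Fintype.card_fin, exp_centreAngle_pow]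

/-- The fundamental representation of `SU(N)` sends `z_N` to the scalar matrix `exp(2πi⌊N/2⌋/N)·1`. [folklore] -/
theorem fundamentalLatticeRep_centre :
    (fundamentalLatticeRep N).ρ ⟨_, centre_smul_one_mem_specialUnitaryGroup N⟩ =
      Complex.exp (↑(2 * Real.pi * ((N / 2 : ℕ) : ℝ) / N) * Complex.I) • (1 : Matrix (Fin N) (Fin N) ℂ) := rfl

/-- `Re tr (exp(iθ)·1_N) = N cos θ`. [folklore] -/
theorem re_trace_exp_smul_one (θ : ℝ) :
    ((Complex.exp (↑θ * Complex.I) • (1 : Matrix (Fin N) (Fin N) ℂ)).trace).re = N * Real.cos θ := by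
  rw [Matrix.trace_smul, Matrix.trace_one, Fintype.card_fin, smul_eq_mul, Complex.mul_re, Complex.natCast_re,
    Complex.natCast_im, mul_zero, sub_zero, Complex.exp_ofReal_mul_I_re, mul_comm]


/-- `6(N − Re tr(exp(iθ)·1_N)) = 6N(1 − cos θ)`. [folklore] -/
theorem six_mul_sub_trace_exp_smul_one (θ : ℝ) :
    6 * ((N : ℝ) - ((Complex.exp (↑θ * Complex.I) • (1 : Matrix (Fin N) (Fin N) ℂ)).trace).re) =
      6 * N * (1 - Real.cos θ) := by
  rw [re_trace_exp_smul_one]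
  ring

/-- **`D(z_N) = 6N(1 − cos(2π⌊N/2⌋/N))`** at the fundamental representation of `SU(N)`. [folklore] -/
theorem six_mul_sub_trace_centre :
    6 * ((((fundamentalLatticeRep N).N : ℕ) : ℝ) -
        ((fundamentalLatticeRep N).ρ ⟨_, centre_smul_one_mem_specialUnitaryGroup N⟩).trace.re) =
      6 * N * (1 - Real.cos (2 * Real.pi * ((N / 2 : ℕ) : ℝ) / N)) := by
  rw [fundamentalLatticeRep_centre]
  exact six_mul_sub_trace_exp_smul_one N _

end Centre

/-! ## §2 The corner price at the fundamental representation of `SU(N)` -/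

section Price

variable (N : ℕ) [MeasurableSpace (Matrix.specialUnitaryGroup (Fin N) ℂ)] [BorelSpace (Matrix.specialUnitaryGroup (Fin N) ℂ)]

/-- **`6N(1 − cos(2π⌊N/2⌋/N)) ≤ C₁`** from clause 1 at one coupling (spacing `s ≤ ℓ`), at the fundamental representation of
`SU(N)`. [folklore] -/
theorem corner_le_C₁_of_e1osc_at_SUN (β : ℝ) {C₁ ℓ s : ℝ} (hsℓ : s ≤ ℓ)
    (hE1 : ∀ (c : Fin 4 → ℤ) (b : ℕ), (b : ℝ) * s ≤ ℓ →
      ∀ (η η' : LGConfig 4 (Matrix.specialUnitaryGroup (Fin N) ℂ)) (x : Fin 4 → ℤ), 1 ≤ depth c b x →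
        |kerE (Matrix.specialUnitaryGroup (Fin N) ℂ) (fundamentalLatticeRep N) β c b η
            (dens (Matrix.specialUnitaryGroup (Fin N) ℂ) (fundamentalLatticeRep N) x) -
          kerE (Matrix.specialUnitaryGroup (Fin N) ℂ) (fundamentalLatticeRep N) β c b η'
            (dens (Matrix.specialUnitaryGroup (Fin N) ℂ) (fundamentalLatticeRep N) x)| ≤ C₁ / (depth c b x : ℝ) ^ 4) :
    6 * N * (1 - Real.cos (2 * Real.pi * ((N / 2 : ℕ) : ℝ) / N)) ≤ C₁ := by
  have h := six_mul_sub_trace_le_of_e1osc_at (Matrix.specialUnitaryGroup (Fin N) ℂ) (fundamentalLatticeRep N) β hsℓ hE1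
    ⟨_, centre_smul_one_mem_specialUnitaryGroup N⟩
  rwa [six_mul_sub_trace_centre] at h

/-- **`6N(1 − cos(2π⌊N/2⌋/N)) ≤ C₁`** for the registered clause 1 at the fundamental representation of `SU(N)` (any unit map
`a → 0`, range `ℓ > 0`). [folklore] -/
theorem corner_le_C₁_of_e1osc_SUN (a : ℝ → ℝ) (ha0 : Tendsto a atTop (𝓝 0)) {C₁ ℓ : ℝ} (hℓ : 0 < ℓ)
    (hE1 : ∃ β₁ : ℝ, ∀ β : ℝ, β₁ ≤ β → ∀ (c : Fin 4 → ℤ) (b : ℕ), (b : ℝ) * a β ≤ ℓ →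
      ∀ (η η' : LGConfig 4 (Matrix.specialUnitaryGroup (Fin N) ℂ)) (x : Fin 4 → ℤ), 1 ≤ depth c b x →
        |kerE (Matrix.specialUnitaryGroup (Fin N) ℂ) (fundamentalLatticeRep N) β c b η
            (dens (Matrix.specialUnitaryGroup (Fin N) ℂ) (fundamentalLatticeRep N) x) -
          kerE (Matrix.specialUnitaryGroup (Fin N) ℂ) (fundamentalLatticeRep N) β c b η'
            (dens (Matrix.specialUnitaryGroup (Fin N) ℂ) (fundamentalLatticeRep N) x)| ≤ C₁ / (depth c b x : ℝ) ^ 4) :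
    6 * N * (1 - Real.cos (2 * Real.pi * ((N / 2 : ℕ) : ℝ) / N)) ≤ C₁ := by
  have h := six_mul_sub_trace_le_of_e1osc (Matrix.specialUnitaryGroup (Fin N) ℂ) (fundamentalLatticeRep N) a ha0 hℓ hE1
    ⟨_, centre_smul_one_mem_specialUnitaryGroup N⟩
  rwa [six_mul_sub_trace_centre] at h

end Price

/-! ## §3 Closed forms: even `N` (`12N`), odd `N` (`6N(1 + cos(π/N))`), `SU(3)` (`27`) -/

section ClosedForms

variable (N : ℕ)

/-- For even `N > 0`: `cos(2π⌊N/2⌋/N) = cos π = −1`. [folklore] -/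
theorem cos_centreAngle_even (hN : Even N) (hN0 : N ≠ 0) : Real.cos (2 * Real.pi * ((N / 2 : ℕ) : ℝ) / N) = -1 := by
  obtain ⟨m, rfl⟩ := hN
  have hm : m ≠ 0 := by rintro rfl; exact hN0 rfl
  have h2 : (m + m) / 2 = m := by omega
  rw [h2]
  have e : 2 * Real.pi * (m : ℝ) / ((m + m : ℕ) : ℝ) = Real.pi := by
    have hm' : (m : ℝ) ≠ 0 := by exact_mod_cast hm
    push_cast
    field_simp
    ring
  rw [e, Real.cos_pi]

/-- For odd `N`: `cos(2π⌊N/2⌋/N) = cos(π − π/N) = −cos(π/N)`. [folklore] -/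
theorem cos_centreAngle_odd (hN : Odd N) : Real.cos (2 * Real.pi * ((N / 2 : ℕ) : ℝ) / N) = -Real.cos (Real.pi / N) := by
  obtain ⟨m, rfl⟩ := hN
  have h2 : (2 * m + 1) / 2 = m := by omega
  rw [h2]
  have e : 2 * Real.pi * (m : ℝ) / ((2 * m + 1 : ℕ) : ℝ) = Real.pi - Real.pi / ((2 * m + 1 : ℕ) : ℝ) := by
    have hm' : ((2 * m + 1 : ℕ) : ℝ) ≠ 0 := by positivity
    field_simp
    push_cast
    ring
  rw [e, Real.cos_pi_sub]

/-- `SU(3)`: `cos(2π⌊3/2⌋/3) = cos(2π/3) = −1/2`. [folklore] -/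
theorem cos_centreAngle_three : Real.cos (2 * Real.pi * ((3 / 2 : ℕ) : ℝ) / (3 : ℕ)) = -(1 / 2) := by
  rw [cos_centreAngle_odd 3 (by decide), Nat.cast_ofNat, Real.cos_pi_div_three]

/-- **`−1 ∈ SU(N)` for even `N`.** [folklore] -/
theorem neg_one_mem_specialUnitaryGroup_of_even (hN : Even N) :
    (-1 : Matrix (Fin N) (Fin N) ℂ) ∈ Matrix.specialUnitaryGroup (Fin N) ℂ := by
  rw [Matrix.mem_specialUnitaryGroup_iff]
  refine ⟨?_, ?_⟩
  · rw [Matrix.mem_unitaryGroup_iff]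
    simp
  · rw [Matrix.det_neg, Matrix.det_one, mul_one, Fintype.card_fin, hN.neg_one_pow]

/-- The fundamental representation of `SU(N)` (`N` even) sends `−1` to `−1`. [folklore] -/
theorem fundamentalLatticeRep_negOne_of_even (hN : Even N) :
    (fundamentalLatticeRep N).ρ ⟨-1, neg_one_mem_specialUnitaryGroup_of_even N hN⟩ = -1 := rfl

variable [MeasurableSpace (Matrix.specialUnitaryGroup (Fin N) ℂ)] [BorelSpace (Matrix.specialUnitaryGroup (Fin N) ℂ)]

/-- **`12N ≤ C₁`** from clause 1 at one coupling at the fundamental representation of `SU(N)`, `N` even. [folklore] -/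
theorem twelve_mul_le_C₁_of_e1osc_at_even (hN : Even N) (β : ℝ) {C₁ ℓ s : ℝ} (hsℓ : s ≤ ℓ)
    (hE1 : ∀ (c : Fin 4 → ℤ) (b : ℕ), (b : ℝ) * s ≤ ℓ →
      ∀ (η η' : LGConfig 4 (Matrix.specialUnitaryGroup (Fin N) ℂ)) (x : Fin 4 → ℤ), 1 ≤ depth c b x →
        |kerE (Matrix.specialUnitaryGroup (Fin N) ℂ) (fundamentalLatticeRep N) β c b η
            (dens (Matrix.specialUnitaryGroup (Fin N) ℂ) (fundamentalLatticeRep N) x) -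
          kerE (Matrix.specialUnitaryGroup (Fin N) ℂ) (fundamentalLatticeRep N) β c b η'
            (dens (Matrix.specialUnitaryGroup (Fin N) ℂ) (fundamentalLatticeRep N) x)| ≤ C₁ / (depth c b x : ℝ) ^ 4) :
    12 * (N : ℝ) ≤ C₁ := by
  have h := twelve_mul_N_le_C₁_of_e1osc_at (Matrix.specialUnitaryGroup (Fin N) ℂ) (fundamentalLatticeRep N) β hsℓ hE1
    (fundamentalLatticeRep_negOne_of_even N hN)
  simpa only [fundamentalLatticeRep_N] using h

/-- **`6N(1 + cos(π/N)) ≤ C₁`** from clause 1 at one coupling at the fundamental representation of `SU(N)`, `N` odd. [folklore] -/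
theorem odd_corner_le_C₁_of_e1osc_at (hN : Odd N) (β : ℝ) {C₁ ℓ s : ℝ} (hsℓ : s ≤ ℓ)
    (hE1 : ∀ (c : Fin 4 → ℤ) (b : ℕ), (b : ℝ) * s ≤ ℓ →
      ∀ (η η' : LGConfig 4 (Matrix.specialUnitaryGroup (Fin N) ℂ)) (x : Fin 4 → ℤ), 1 ≤ depth c b x →
        |kerE (Matrix.specialUnitaryGroup (Fin N) ℂ) (fundamentalLatticeRep N) β c b η
            (dens (Matrix.specialUnitaryGroup (Fin N) ℂ) (fundamentalLatticeRep N) x) -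
          kerE (Matrix.specialUnitaryGroup (Fin N) ℂ) (fundamentalLatticeRep N) β c b η'
            (dens (Matrix.specialUnitaryGroup (Fin N) ℂ) (fundamentalLatticeRep N) x)| ≤ C₁ / (depth c b x : ℝ) ^ 4) :
    6 * N * (1 + Real.cos (Real.pi / N)) ≤ C₁ := by
  have h := corner_le_C₁_of_e1osc_at_SUN N β hsℓ hE1
  rw [cos_centreAngle_odd N hN] at h
  linarith

/-- **`27 ≤ C₁`** from clause 1 at one coupling at the fundamental representation of `SU(3)` — the gauge group of
`YangMillsOS` (`D(z_3) = 6·3·(1 + ½) = 27`). [folklore] -/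
theorem twentyseven_le_C₁_of_e1osc_at_SU3 [MeasurableSpace (Matrix.specialUnitaryGroup (Fin 3) ℂ)]
    [BorelSpace (Matrix.specialUnitaryGroup (Fin 3) ℂ)] (β : ℝ) {C₁ ℓ s : ℝ} (hsℓ : s ≤ ℓ)
    (hE1 : ∀ (c : Fin 4 → ℤ) (b : ℕ), (b : ℝ) * s ≤ ℓ →
      ∀ (η η' : LGConfig 4 (Matrix.specialUnitaryGroup (Fin 3) ℂ)) (x : Fin 4 → ℤ), 1 ≤ depth c b x →
        |kerE (Matrix.specialUnitaryGroup (Fin 3) ℂ) (fundamentalLatticeRep 3) β c b η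
            (dens (Matrix.specialUnitaryGroup (Fin 3) ℂ) (fundamentalLatticeRep 3) x) -
          kerE (Matrix.specialUnitaryGroup (Fin 3) ℂ) (fundamentalLatticeRep 3) β c b η'
            (dens (Matrix.specialUnitaryGroup (Fin 3) ℂ) (fundamentalLatticeRep 3) x)| ≤ C₁ / (depth c b x : ℝ) ^ 4) :
    27 ≤ C₁ := by
  have h := odd_corner_le_C₁_of_e1osc_at 3 (by decide) β hsℓ hE1
  rw [Nat.cast_ofNat, Real.cos_pi_div_three] at h
  linarith

/-- **`27 ≤ C₁`** for the registered clause 1 at the fundamental representation of `SU(3)` (any unit map `a → 0`, `ℓ > 0`).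
[folklore] -/
theorem twentyseven_le_C₁_of_e1osc_SU3 [MeasurableSpace (Matrix.specialUnitaryGroup (Fin 3) ℂ)]
    [BorelSpace (Matrix.specialUnitaryGroup (Fin 3) ℂ)] (a : ℝ → ℝ) (ha0 : Tendsto a atTop (𝓝 0)) {C₁ ℓ : ℝ}
    (hℓ : 0 < ℓ)
    (hE1 : ∃ β₁ : ℝ, ∀ β : ℝ, β₁ ≤ β → ∀ (c : Fin 4 → ℤ) (b : ℕ), (b : ℝ) * a β ≤ ℓ →
      ∀ (η η' : LGConfig 4 (Matrix.specialUnitaryGroup (Fin 3) ℂ)) (x : Fin 4 → ℤ), 1 ≤ depth c b x →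
        |kerE (Matrix.specialUnitaryGroup (Fin 3) ℂ) (fundamentalLatticeRep 3) β c b η
            (dens (Matrix.specialUnitaryGroup (Fin 3) ℂ) (fundamentalLatticeRep 3) x) -
          kerE (Matrix.specialUnitaryGroup (Fin 3) ℂ) (fundamentalLatticeRep 3) β c b η'
            (dens (Matrix.specialUnitaryGroup (Fin 3) ℂ) (fundamentalLatticeRep 3) x)| ≤ C₁ / (depth c b x : ℝ) ^ 4) :
    27 ≤ C₁ := by
  have h := corner_le_C₁_of_e1osc_SUN 3 a ha0 hℓ hE1
  rw [cos_centreAngle_three, Nat.cast_ofNat] at h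
  linarith

end ClosedForms

/-! ## §4 Optimality of `12N`: `D(g) ≤ 12N` for every unitary lattice representation -/

section Optimal

variable {G : Type} [Group G] [TopologicalSpace G] (r : LatticeRep G)

/-- `−N ≤ Re tr ρ(g)` for a unitary lattice representation. [folklore] -/
theorem neg_N_le_re_trace (g : G) : -(r.N : ℝ) ≤ (r.ρ g).trace.re := by
  rw [Matrix.trace, Complex.re_sum]
  calc -(r.N : ℝ) = ∑ _i : Fin r.N, (-1 : ℝ) := by simp
    _ ≤ ∑ i, ((r.ρ g).diag i).re := Finset.sum_le_sum fun i _ =>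
        (abs_le.1 ((Complex.abs_re_le_norm _).trans (entry_norm_bound_of_unitary (r.mem_unitary g) i i))).1

/-- **`D(g) = 6(N − Re tr ρ(g)) ≤ 12N`** for every `g`: the even-`N` corner price `12N` is the largest value the corner lemma
can give. [folklore] -/
theorem six_mul_sub_trace_le_twelve_mul (g : G) : 6 * ((r.N : ℝ) - (r.ρ g).trace.re) ≤ 12 * r.N := by
  have h := neg_N_le_re_trace r g
  linarith

end Optimal

/-! ## §5 The corner floors of the margins at `SU(N)` -/

section Floors

variable (N : ℕ) [MeasurableSpace (Matrix.specialUnitaryGroup (Fin N) ℂ)] [BorelSpace (Matrix.specialUnitaryGroup (Fin N) ℂ)]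

/-- **`ε + 2D_N²·((s/κ)⁴S_θ)((s/κ)⁴S_v) ≤ Q2(θv,v)`**, `D_N = 6N(1 − cos(2π⌊N/2⌋/N))`, from the registered clauses 1 and 4 at
the fundamental representation of `SU(N)`, one coupling. [folklore] -/
theorem q2_ge_cornerSUN_of_clause4_at (β : ℝ) {C₁ C₂ ℓ s κ : ℝ} (hC₂ : 0 ≤ C₂) (hsℓ : s ≤ ℓ)
    (hE1 : ∀ (c : Fin 4 → ℤ) (b : ℕ), (b : ℝ) * s ≤ ℓ →
      ∀ (η η' : LGConfig 4 (Matrix.specialUnitaryGroup (Fin N) ℂ)) (x : Fin 4 → ℤ), 1 ≤ depth c b x →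
        |kerE (Matrix.specialUnitaryGroup (Fin N) ℂ) (fundamentalLatticeRep N) β c b η
            (dens (Matrix.specialUnitaryGroup (Fin N) ℂ) (fundamentalLatticeRep N) x) -
          kerE (Matrix.specialUnitaryGroup (Fin N) ℂ) (fundamentalLatticeRep N) β c b η'
            (dens (Matrix.specialUnitaryGroup (Fin N) ℂ) (fundamentalLatticeRep N) x)| ≤ C₁ / (depth c b x : ℝ) ^ 4)
    {v : 𝓢(EuclideanSpace ℝ (Fin 4), ℝ)} {ε : ℝ} {L : ℕ}
    (hfloor : ε + 2 * (C₁ * (s / κ) ^ 4 * ∑ x ∈ box 4 L, |thetaTest 4 v (s • siteToE x)|) *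
          (C₁ * (s / κ) ^ 4 * ∑ y ∈ box 4 L, |v (s • siteToE y)|) +
        C₂ * (s / κ) ^ 4 * ∑ x ∈ box 4 L, ∑ y ∈ box 4 L,
          |thetaTest 4 v (s • siteToE x)| * |v (s • siteToE y)| / (1 + ‖siteToE (y - x)‖) ^ 4 ≤
      Q2 (Matrix.specialUnitaryGroup (Fin N) ℂ) (fundamentalLatticeRep N) β L s (thetaTest 4 v) v) :
    ε + 2 * (6 * N * (1 - Real.cos (2 * Real.pi * ((N / 2 : ℕ) : ℝ) / N))) ^ 2 *
        (((s / κ) ^ 4 * ∑ x ∈ box 4 L, |thetaTest 4 v (s • siteToE x)|) *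
          ((s / κ) ^ 4 * ∑ y ∈ box 4 L, |v (s • siteToE y)|)) ≤
      Q2 (Matrix.specialUnitaryGroup (Fin N) ℂ) (fundamentalLatticeRep N) β L s (thetaTest 4 v) v := by
  have h := q2_ge_cornerMargin_of_clause4_at (Matrix.specialUnitaryGroup (Fin N) ℂ) (fundamentalLatticeRep N) β hC₂ hsℓ hE1
    hfloor ⟨_, centre_smul_one_mem_specialUnitaryGroup N⟩
  rw [six_mul_sub_trace_centre] at h
  have e : ∀ D t Sθ Sv : ℝ, 2 * (D * t * Sθ) * (D * t * Sv) = 2 * D ^ 2 * ((t * Sθ) * (t * Sv)) := fun D t Sθ Sv => by ring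
  rw [e] at h
  exact h

/-- **`ε + 2D_N³(s/κ)¹²·S_fS_gS_h ≤ |Q3(f,g,h)|`**, `D_N = 6N(1 − cos(2π⌊N/2⌋/N))`, from the registered clauses 1 and 5 at the
fundamental representation of `SU(N)`, one coupling. [folklore] -/
theorem absQ3_ge_cornerSUN_of_clause5_at (β : ℝ) {C₁ C₂ C₃ ℓ s κ : ℝ} (hC₂ : 0 ≤ C₂) (hC₃ : 0 ≤ C₃) (hsℓ : s ≤ ℓ)
    (hE1 : ∀ (c : Fin 4 → ℤ) (b : ℕ), (b : ℝ) * s ≤ ℓ →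
      ∀ (η η' : LGConfig 4 (Matrix.specialUnitaryGroup (Fin N) ℂ)) (x : Fin 4 → ℤ), 1 ≤ depth c b x →
        |kerE (Matrix.specialUnitaryGroup (Fin N) ℂ) (fundamentalLatticeRep N) β c b η
            (dens (Matrix.specialUnitaryGroup (Fin N) ℂ) (fundamentalLatticeRep N) x) -
          kerE (Matrix.specialUnitaryGroup (Fin N) ℂ) (fundamentalLatticeRep N) β c b η'
            (dens (Matrix.specialUnitaryGroup (Fin N) ℂ) (fundamentalLatticeRep N) x)| ≤ C₁ / (depth c b x : ℝ) ^ 4)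
    {f g h : 𝓢(EuclideanSpace ℝ (Fin 4), ℝ)} {ε : ℝ} {L : ℕ}
    (hfloor : ε + ∑ x ∈ box 4 L, ∑ y ∈ box 4 L, ∑ z ∈ box 4 L,
        |f (s • siteToE x)| * |g (s • siteToE y)| * |h (s • siteToE z)| *
          (2 * ((C₁ * (s / κ) ^ 4) * (C₂ * (s / κ) ^ 4 / (1 + ‖siteToE (z - y)‖) ^ 4) +
                (C₁ * (s / κ) ^ 4) * (C₂ * (s / κ) ^ 4 / (1 + ‖siteToE (z - x)‖) ^ 4) +
                (C₁ * (s / κ) ^ 4) * (C₂ * (s / κ) ^ 4 / (1 + ‖siteToE (y - x)‖) ^ 4) +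
                (C₁ * (s / κ) ^ 4) * (C₁ * (s / κ) ^ 4) * (C₁ * (s / κ) ^ 4)) +
            C₃ * (s / κ) ^ 4 / (1 + min (min ‖siteToE (y - x)‖ ‖siteToE (z - y)‖) ‖siteToE (z - x)‖) ^ 8) ≤
      |Q3 (Matrix.specialUnitaryGroup (Fin N) ℂ) (fundamentalLatticeRep N) β L s f g h|) :
    ε + 2 * (6 * N * (1 - Real.cos (2 * Real.pi * ((N / 2 : ℕ) : ℝ) / N))) ^ 3 * (s / κ) ^ 12 *
        ((∑ x ∈ box 4 L, |f (s • siteToE x)|) * (∑ y ∈ box 4 L, |g (s • siteToE y)|) *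
          (∑ z ∈ box 4 L, |h (s • siteToE z)|)) ≤
      |Q3 (Matrix.specialUnitaryGroup (Fin N) ℂ) (fundamentalLatticeRep N) β L s f g h| := by
  have hq := q3_ge_cornerMargin_of_clause5_at (Matrix.specialUnitaryGroup (Fin N) ℂ) (fundamentalLatticeRep N) β hC₂ hC₃ hsℓ
    hE1 hfloor ⟨_, centre_smul_one_mem_specialUnitaryGroup N⟩
  rw [six_mul_sub_trace_centre] at hq
  have e : ∀ D t : ℝ, 2 * (D * t ^ 4) ^ 3 = 2 * D ^ 3 * t ^ 12 := fun D t => by ring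
  rw [e] at hq
  exact hq

/-- **`SU(3)`: `ε + 1458·((s/κ)⁴S_θ)((s/κ)⁴S_v) ≤ Q2(θv,v)`** from the registered clauses 1 and 4 at the fundamental representation
of `SU(3)`, one coupling (`2·27² = 1458`). [folklore] -/
theorem q2_ge_1458_of_clause4_at_SU3 [MeasurableSpace (Matrix.specialUnitaryGroup (Fin 3) ℂ)]
    [BorelSpace (Matrix.specialUnitaryGroup (Fin 3) ℂ)] (β : ℝ) {C₁ C₂ ℓ s κ : ℝ} (hC₂ : 0 ≤ C₂) (hsℓ : s ≤ ℓ)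
    (hE1 : ∀ (c : Fin 4 → ℤ) (b : ℕ), (b : ℝ) * s ≤ ℓ →
      ∀ (η η' : LGConfig 4 (Matrix.specialUnitaryGroup (Fin 3) ℂ)) (x : Fin 4 → ℤ), 1 ≤ depth c b x →
        |kerE (Matrix.specialUnitaryGroup (Fin 3) ℂ) (fundamentalLatticeRep 3) β c b η
            (dens (Matrix.specialUnitaryGroup (Fin 3) ℂ) (fundamentalLatticeRep 3) x) -
          kerE (Matrix.specialUnitaryGroup (Fin 3) ℂ) (fundamentalLatticeRep 3) β c b η'
            (dens (Matrix.specialUnitaryGroup (Fin 3) ℂ) (fundamentalLatticeRep 3) x)| ≤ C₁ / (depth c b x : ℝ) ^ 4)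
    {v : 𝓢(EuclideanSpace ℝ (Fin 4), ℝ)} {ε : ℝ} {L : ℕ}
    (hfloor : ε + 2 * (C₁ * (s / κ) ^ 4 * ∑ x ∈ box 4 L, |thetaTest 4 v (s • siteToE x)|) *
          (C₁ * (s / κ) ^ 4 * ∑ y ∈ box 4 L, |v (s • siteToE y)|) +
        C₂ * (s / κ) ^ 4 * ∑ x ∈ box 4 L, ∑ y ∈ box 4 L,
          |thetaTest 4 v (s • siteToE x)| * |v (s • siteToE y)| / (1 + ‖siteToE (y - x)‖) ^ 4 ≤
      Q2 (Matrix.specialUnitaryGroup (Fin 3) ℂ) (fundamentalLatticeRep 3) β L s (thetaTest 4 v) v) :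
    ε + 1458 * (((s / κ) ^ 4 * ∑ x ∈ box 4 L, |thetaTest 4 v (s • siteToE x)|) *
        ((s / κ) ^ 4 * ∑ y ∈ box 4 L, |v (s • siteToE y)|)) ≤
      Q2 (Matrix.specialUnitaryGroup (Fin 3) ℂ) (fundamentalLatticeRep 3) β L s (thetaTest 4 v) v := by
  have h := q2_ge_cornerSUN_of_clause4_at 3 β hC₂ hsℓ hE1 hfloor
  rw [cos_centreAngle_three, Nat.cast_ofNat] at h
  have e : (2 : ℝ) * (6 * 3 * (1 - -(1 / 2))) ^ 2 = 1458 := by norm_num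
  rwa [e] at h

/-- **`SU(3)`: `ε + 39366·(s/κ)¹²·S_fS_gS_h ≤ |Q3(f,g,h)|`** from the registered clauses 1 and 5 at the fundamental representation
of `SU(3)`, one coupling (`2·27³ = 39366`). [folklore] -/
theorem absQ3_ge_39366_of_clause5_at_SU3 [MeasurableSpace (Matrix.specialUnitaryGroup (Fin 3) ℂ)]
    [BorelSpace (Matrix.specialUnitaryGroup (Fin 3) ℂ)] (β : ℝ) {C₁ C₂ C₃ ℓ s κ : ℝ} (hC₂ : 0 ≤ C₂) (hC₃ : 0 ≤ C₃)
    (hsℓ : s ≤ ℓ)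
    (hE1 : ∀ (c : Fin 4 → ℤ) (b : ℕ), (b : ℝ) * s ≤ ℓ →
      ∀ (η η' : LGConfig 4 (Matrix.specialUnitaryGroup (Fin 3) ℂ)) (x : Fin 4 → ℤ), 1 ≤ depth c b x →
        |kerE (Matrix.specialUnitaryGroup (Fin 3) ℂ) (fundamentalLatticeRep 3) β c b η
            (dens (Matrix.specialUnitaryGroup (Fin 3) ℂ) (fundamentalLatticeRep 3) x) -
          kerE (Matrix.specialUnitaryGroup (Fin 3) ℂ) (fundamentalLatticeRep 3) β c b η'
            (dens (Matrix.specialUnitaryGroup (Fin 3) ℂ) (fundamentalLatticeRep 3) x)| ≤ C₁ / (depth c b x : ℝ) ^ 4)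
    {f g h : 𝓢(EuclideanSpace ℝ (Fin 4), ℝ)} {ε : ℝ} {L : ℕ}
    (hfloor : ε + ∑ x ∈ box 4 L, ∑ y ∈ box 4 L, ∑ z ∈ box 4 L,
        |f (s • siteToE x)| * |g (s • siteToE y)| * |h (s • siteToE z)| *
          (2 * ((C₁ * (s / κ) ^ 4) * (C₂ * (s / κ) ^ 4 / (1 + ‖siteToE (z - y)‖) ^ 4) +
                (C₁ * (s / κ) ^ 4) * (C₂ * (s / κ) ^ 4 / (1 + ‖siteToE (z - x)‖) ^ 4) +
                (C₁ * (s / κ) ^ 4) * (C₂ * (s / κ) ^ 4 / (1 + ‖siteToE (y - x)‖) ^ 4) +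
                (C₁ * (s / κ) ^ 4) * (C₁ * (s / κ) ^ 4) * (C₁ * (s / κ) ^ 4)) +
            C₃ * (s / κ) ^ 4 / (1 + min (min ‖siteToE (y - x)‖ ‖siteToE (z - y)‖) ‖siteToE (z - x)‖) ^ 8) ≤
      |Q3 (Matrix.specialUnitaryGroup (Fin 3) ℂ) (fundamentalLatticeRep 3) β L s f g h|) :
    ε + 39366 * (s / κ) ^ 12 * ((∑ x ∈ box 4 L, |f (s • siteToE x)|) * (∑ y ∈ box 4 L, |g (s • siteToE y)|) *
        (∑ z ∈ box 4 L, |h (s • siteToE z)|)) ≤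
      |Q3 (Matrix.specialUnitaryGroup (Fin 3) ℂ) (fundamentalLatticeRep 3) β L s f g h| := by
  have hq := absQ3_ge_cornerSUN_of_clause5_at 3 β hC₂ hC₃ hsℓ hE1 hfloor
  rw [cos_centreAngle_three, Nat.cast_ofNat] at hq
  have e : (2 : ℝ) * (6 * 3 * (1 - -(1 / 2))) ^ 3 = 39366 := by norm_num
  rwa [e] at hq

end Floors

end Summit.QuantumFields.YangMills.Cruxes.NT.CornerPrice

end
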